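import Summits.ValiantsHypothesis.ValiantsHypothesis.Theorems.LacunarySymmetroidMatrixDescartesCensusRootLimit

/-!
# `MatrixDescartes` census — the ROOT-COUNT LIMIT LEMMA for `2 × 2` PENCILS (entrywise-convergent letters)

HONEST FRAMING.  Object-search cell `pub-symmetroid`, crux `Theses.LacunarySymmetroid.MatrixDescartes`
(stmt-ValiantsHypothesis-18050); this file is a HELPER of that item with no closure claim.  It specialises the root-count
limit lemma of `…CensusRootLimit` to the census object: on a FIXED support `d`, if the letters `S n` of real `2 × 2`
pencils converge ENTRYWISE to `S₀`, then the determinants converge coefficientwise (`det_pencil_coeff_tendsto`; the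
coefficients are finite sums of products of letters), and if every pencil `S n` has `M` distinct roots of its
determinant in a compact `[α, β]` while the limit determinant is non-zero, the limit has `≥ M` roots in `[α, β]` counted
with multiplicity (`card_roots_det_pencil_ge_of_tendsto`).  This is the kernel form of the «IN THE LIMIT» step of the
theory seat's RESIDUE-READING note §2(f)/(k)/(l) (theory g20, 2026-08-25) for the V = 20 programme of
`DoorA26 = PosRootLawAt 2 6 19` (OPEN, never asserted); the compactness of the large roots and the convergence of the
(normalised) letters are HYPOTHESES here — the located inputs the note names — not conclusions.  Nothing bounds `ζ`;
nothing bears on `MatrixDescartes` or on `VP ≠ VNP`.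

[folklore] Elementary; no citation exists or is needed.
-/

-- `Summit.ValiantsHypothesis.ValiantsHypothesis.…` repeats a component by the D-0017 layout
-- (single-conjunct summit), which the `dupNamespace` linter flags; the name is mandated.
set_option linter.dupNamespace false

open Polynomial Finset Filter
open scoped BigOperators Polynomial Topology

namespace Summit.ValiantsHypothesis.ValiantsHypothesis.Theorems.LacunarySymmetroidMatrixDescartes.Census

/-- entries of the `2 × 2` pencil `∑ X^{d l} • (S l).map C`. [folklore] -/
theorem pencil_sum_apply {K : ℕ} (d : Fin K → ℕ) (S : Fin K → Matrix (Fin 2) (Fin 2) ℝ) (i j : Fin 2) :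
    (∑ l, (X : ℝ[X]) ^ d l • (S l).map C) i j = ∑ l, (X : ℝ[X]) ^ d l * C ((S l) i j) := by
  simp [Matrix.sum_apply, Matrix.smul_apply, Matrix.map_apply, smul_eq_mul]

/-- coefficients of an entry of the pencil are finite sums of letters. [folklore] -/
theorem pencil_entry_coeff {K : ℕ} (d : Fin K → ℕ) (S : Fin K → Matrix (Fin 2) (Fin 2) ℝ) (i j : Fin 2) (k : ℕ) :
    ((∑ l, (X : ℝ[X]) ^ d l • (S l).map C) i j).coeff k = ∑ l, if d l = k then (S l) i j else 0 := by
  rw [pencil_sum_apply, finsetSum_coeff]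
  apply Finset.sum_congr rfl
  intro l _
  rw [coeff_X_pow_mul', coeff_C]
  by_cases h : d l = k
  · subst h; simp
  · by_cases h' : d l ≤ k
    · have : k - d l ≠ 0 := by omega
      simp [h', this, h]
    · simp [h', h]

/-- entrywise convergence of letters gives coefficientwise convergence of every pencil entry. [folklore] -/
theorem pencil_entry_coeff_tendsto {K : ℕ} (d : Fin K → ℕ) (S : ℕ → Fin K → Matrix (Fin 2) (Fin 2) ℝ)
    (S₀ : Fin K → Matrix (Fin 2) (Fin 2) ℝ) (hS : ∀ l i j, Tendsto (fun n => S n l i j) atTop (𝓝 (S₀ l i j)))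
    (i j : Fin 2) (k : ℕ) :
    Tendsto (fun n => ((∑ l, (X : ℝ[X]) ^ d l • (S n l).map C) i j).coeff k) atTop
      (𝓝 (((∑ l, (X : ℝ[X]) ^ d l • (S₀ l).map C) i j).coeff k)) := by
  simp_rw [pencil_entry_coeff]
  refine tendsto_finsetSum _ fun l _ => ?_
  by_cases h : d l = k
  · simp only [h, if_true]; exact hS l i j
  · simp only [h, if_false]; exact tendsto_const_nhds

/-- coefficientwise convergence is preserved by products … [folklore] -/
theorem coeff_mul_tendsto {P Q : ℕ → ℝ[X]} {p q : ℝ[X]}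
    (hP : ∀ k, Tendsto (fun n => (P n).coeff k) atTop (𝓝 (p.coeff k)))
    (hQ : ∀ k, Tendsto (fun n => (Q n).coeff k) atTop (𝓝 (q.coeff k))) (k : ℕ) :
    Tendsto (fun n => (P n * Q n).coeff k) atTop (𝓝 ((p * q).coeff k)) := by
  simp_rw [coeff_mul]
  exact tendsto_finsetSum _ fun x _ => (hP x.1).mul (hQ x.2)

/-- … and by differences. [folklore] -/
theorem coeff_sub_tendsto {P Q : ℕ → ℝ[X]} {p q : ℝ[X]}
    (hP : ∀ k, Tendsto (fun n => (P n).coeff k) atTop (𝓝 (p.coeff k)))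
    (hQ : ∀ k, Tendsto (fun n => (Q n).coeff k) atTop (𝓝 (q.coeff k))) (k : ℕ) :
    Tendsto (fun n => (P n - Q n).coeff k) atTop (𝓝 ((p - q).coeff k)) := by
  simp_rw [coeff_sub]
  exact (hP k).sub (hQ k)

/-- **Entrywise-convergent letters ⇒ coefficientwise-convergent determinants** (for `2 × 2` pencils on a fixed support).
[folklore] -/
theorem det_pencil_coeff_tendsto {K : ℕ} (d : Fin K → ℕ) (S : ℕ → Fin K → Matrix (Fin 2) (Fin 2) ℝ)
    (S₀ : Fin K → Matrix (Fin 2) (Fin 2) ℝ) (hS : ∀ l i j, Tendsto (fun n => S n l i j) atTop (𝓝 (S₀ l i j))) (k : ℕ) :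
    Tendsto (fun n => (∑ l, (X : ℝ[X]) ^ d l • (S n l).map C).det.coeff k) atTop
      (𝓝 ((∑ l, (X : ℝ[X]) ^ d l • (S₀ l).map C).det.coeff k)) := by
  simp_rw [Matrix.det_fin_two]
  exact coeff_sub_tendsto
    (coeff_mul_tendsto (pencil_entry_coeff_tendsto d S S₀ hS 0 0) (pencil_entry_coeff_tendsto d S S₀ hS 1 1))
    (coeff_mul_tendsto (pencil_entry_coeff_tendsto d S S₀ hS 0 1) (pencil_entry_coeff_tendsto d S S₀ hS 1 0)) k

/-- degree bound for the determinant of a `2 × 2` pencil: `≤ 2 · max d`. [folklore] -/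
theorem natDegree_det_pencil_le {K : ℕ} (d : Fin K → ℕ) (S : Fin K → Matrix (Fin 2) (Fin 2) ℝ) (D : ℕ)
    (hD : ∀ l, d l ≤ D) : (∑ l, (X : ℝ[X]) ^ d l • (S l).map C).det.natDegree ≤ 2 * D := by
  have hent : ∀ i j, ((∑ l, (X : ℝ[X]) ^ d l • (S l).map C) i j).natDegree ≤ D := by
    intro i j
    rw [pencil_sum_apply]
    apply natDegree_sum_le_of_forall_le
    intro l _
    exact natDegree_mul_le.trans (by simpa using hD l)
  rw [Matrix.det_fin_two]
  refine (natDegree_sub_le _ _).trans (max_le ?_ ?_)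
  · exact natDegree_mul_le.trans (by have := hent 0 0; have := hent 1 1; omega)
  · exact natDegree_mul_le.trans (by have := hent 0 1; have := hent 1 0; omega)

/-- **ROOT-COUNT LIMIT LEMMA FOR PENCILS.**  On a fixed support `d`, let the letters `S n` converge entrywise to `S₀` whose
pencil has non-zero determinant, and suppose each pencil `S n` has at least `M` distinct roots of its determinant in
`[α, β]`.  Then the limit pencil has at least `M` roots of its determinant in `[α, β]` counted with multiplicity.
(RESIDUE-READING §2(f)/(k): a sequence of twenties whose `17` large roots stay in a compact `[α, β] ⊂ (0, ∞)` and whose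
letters converge to a boundary form forces `≥ 17` positive roots of the boundary determinant with multiplicity.) [folklore] -/
theorem card_roots_det_pencil_ge_of_tendsto {K M : ℕ} (d : Fin K → ℕ) (S : ℕ → Fin K → Matrix (Fin 2) (Fin 2) ℝ)
    (S₀ : Fin K → Matrix (Fin 2) (Fin 2) ℝ) (hS : ∀ l i j, Tendsto (fun n => S n l i j) atTop (𝓝 (S₀ l i j)))
    (h0 : (∑ l, (X : ℝ[X]) ^ d l • (S₀ l).map C).det ≠ 0) {α β : ℝ}
    (hM : ∀ n, M ≤ (((∑ l, (X : ℝ[X]) ^ d l • (S n l).map C).det.roots.toFinset).filter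
      (fun t => α ≤ t ∧ t ≤ β)).card) :
    M ≤ Multiset.card ((∑ l, (X : ℝ[X]) ^ d l • (S₀ l).map C).det.roots.filter (fun t => α ≤ t ∧ t ≤ β)) := by
  classical
  -- a uniform degree bound
  have hD : ∀ l, d l ≤ Finset.univ.sup d := fun l => Finset.le_sup (mem_univ l)
  exact card_roots_ge_of_coeff_tendsto' h0 (fun n => natDegree_det_pencil_le d (S n) _ hD)
    (det_pencil_coeff_tendsto d S S₀ hS) hM

end Summit.ValiantsHypothesis.ValiantsHypothesis.Theorems.LacunarySymmetroidMatrixDescartes.Census
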